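import Literature.AnabelianGeometry.EtaleTheta.SettingModelLevelKernels
import Literature.AnabelianGeometry.EtaleTheta.SettingModelChiTwist
import Literature.AnabelianGeometry.AbsoluteAnabelian.ZHatCompletionFreeProcyclic
import HarnessLib

/-!
# A model of the [EtTh] §1 root — `Ẑ`-coordinates on the theta centre `[F̂₂,F̂₂]⁻/[[F̂₂,F̂₂],F̂₂]⁻ ≅ Ẑ(χ)`

Mochizuki, *The étale theta function …*, Publ. RIMS **45** (2009) [EtTh], §1, PRIMS PDF p. 12
[cite: MochizukiEtTh2009, §1 p.12]: "`(Ẑ(1) ≅) Δ_Θ ⊆ Δ^Θ_X`", "the image of `∧² Δ^ell_X` in `Δ^Θ_X`".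
Layer L2 of the abc-iut cell (seat abc-iut-L6-d6 gen 4; abc-iut-L2-lead gen 3 RULINGS #13 R100, file F1c-core of
the R78 «χ-twisted root model» cluster). PROOF-ONLY and MODEL-INDEPENDENT (profinite free group `F̂₂` only), so it
serves abc-iut-L2-t1's finer model `model₂` and the twisted model alike; sequel of `SettingModelLevelKernels.lean`
(this seat) over abc-iut-w5-d024's `SettingModelChiTwist.lean` (`twist φ`, `hHat_twist`) and abc-iut-L2-t1's
`SettingModel2Theta.lean` (`hHat`, `modN`).

With `c := ⁅a, b⁆ ∈ F₂` and any continuous `f : Ẑ → F̂₂` with `f(ι 1) = η(c)` (such `f` — "`c^Ẑ`" — exist: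
`exists_cPow`, abc-iut-L4's pointed universal property of `Ẑ`):

* `modN_eq_level` — the two level characters of the tree agree (`SettingModel.modN N = ZHatLevel.level N`);
* `exists_zHat_forall_modN_eq` — every compatible family `(c_N ∈ ℤ/N)_N` is the level family of some
  `t ∈ Ẑ` (abc-iut's `ZHatLevel.powEnd`); in particular the `z`- (resp. `y`-) coordinates of `(ĥ_N x)_N` for ANY
  `x ∈ F̂₂` come from some `t ∈ Ẑ` (`exists_zHat_forall_hHat_z_eq`, `exists_zHat_forall_hHat_y_eq`);
* `apply_iotaZ_of_cPowSpec`, `eHat_apply_of_cPowSpec`, **`hHat_apply_of_cPowSpec`** (`ĥ_N(c^t) = (0,0,t mod N)`),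
  `apply_mem_closure_commutator_of_cPowSpec` (`c^t ∈ [F̂₂,F̂₂]⁻`);
* **`exists_mul_inv_cPow_mem_closure₃`** — every `x ∈ [F̂₂,F̂₂]⁻` is `≡ c^t (mod [[F̂₂,F̂₂],F̂₂]⁻)` for some
  `t ∈ Ẑ`, and **`eq_one_of_cPow_mem_closure₃`** — `c^t ∈ [[F̂₂,F̂₂],F̂₂]⁻ ⇒ t = 1`: together with
  `inv_mul_mem_KTheta₂_iff_forall_hHat_z_eq` (sequel file) this says `t ↦ c^t` induces a BIJECTION
  `Ẑ ≅ [F̂₂,F̂₂]⁻/[[F̂₂,F̂₂],F̂₂]⁻ = Δ_Θ` of the models — explicit Ẑ-COORDINATES on the theta centre;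
* **`twist_cPow_mul_inv_mem_closure₃`** — `θ_φ(c^t) ≡ c^{φ t} (mod [[F̂₂,F̂₂],F̂₂]⁻)` for every `φ ∈ Aut(Ẑ)`:
  in these coordinates the twist `θ_φ : a ↦ a, b ↦ b^φ` of `SettingModelChiTwist.lean` acts on `Δ_Θ` through
  `φ` itself — at the twisted model (`φ = χ(σ)`) this is **`Δ_Θ ≅ Ẑ(χ) = Ẑ(1)`**, the χ-isotypy the Kummer-data
  inhabitation (cluster file F6) needs.

Classical profinite group theory ([RibesZalesskii2010, Thm 2.7.1] for `Ẑ`); nothing of [EtTh] is asserted; a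
model is consistency evidence only; no side is taken on [IUTchIII] Cor. 3.12. No definitions, no instances, no
Prop facts.
-/

noncomputable section

namespace Literature.AnabelianGeometry.EtaleTheta.SettingModel

open Literature.AnabelianGeometry.SemiGraphs
open Literature.AnabelianGeometry.AbsoluteAnabelian
open CategoryTheory Function
open scoped commutatorElement

/-! ### The two level characters of `Ẑ` agree; compatible families come from `Ẑ` -/

/-- `SettingModel.modN N` (abc-iut-L2-t1) and `ZHatLevel.level N` (abc-iut, `CyclotomeZHatAction.lean`) agree:
write `t = z^N · ι k`. [cite: RibesZalesskii2010, Thm 2.7.1] -/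
theorem modN_eq_level (N : ℕ+) (t : ZH) : modN N t = ZHatLevel.level N t := by
  obtain ⟨k, hk⟩ := ZHatLevel.exists_level_eq_level_eta N t
  have h1 : ZHatLevel.level N (t * (ZHatLevel.eta k)⁻¹) = 1 := by
    rw [map_mul, map_inv, hk, mul_inv_cancel]
  obtain ⟨z, hz⟩ := (ZHatLevel.level_eq_one_iff_exists_pow N _).mp h1
  have ht : t = z ^ (N : ℕ) * ZHatLevel.eta k := by rw [hz, inv_mul_cancel_right]
  have hpow : ∀ m : Multiplicative (ZMod N), m ^ (N : ℕ) = 1 := fun m => by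
    rw [← ofAdd_toAdd m, ← ofAdd_nsmul, nsmul_eq_mul, ZMod.natCast_self, zero_mul, ofAdd_zero]
  have hmod : modN N (ZHatLevel.eta k) = Multiplicative.ofAdd (k : ZMod N) :=
    modN_iotaZ N (Multiplicative.ofAdd k)
  rw [ht, map_mul, map_mul, map_pow, map_pow, hpow, hpow, one_mul, one_mul, hmod, ZHatLevel.level_eta]

/-- **Every compatible family `(c_N ∈ ℤ/N)_N` is the level family of an element of `Ẑ`** (`lim_N ℤ/N = Ẑ`;
`t := (η 1)^c` via `ZHatLevel.powEnd`). [cite: RibesZalesskii2010, Thm 2.7.1] -/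
theorem exists_zHat_forall_modN_eq (c : ∀ N : ℕ+, ZMod N)
    (hc : ∀ (n N : ℕ+) (h : (n : ℕ) ∣ N), ZMod.castHom h (ZMod n) (c N) = c n) :
    ∃ t : ZH, ∀ N : ℕ+, Multiplicative.toAdd (modN N t) = c N := by
  refine ⟨ZHatLevel.powEnd ⟨c, hc⟩ (ZHatLevel.eta 1), fun N => ?_⟩
  rw [modN_eq_level, ZHatLevel.toAdd_level_powEnd, ZHatLevel.level_eta, toAdd_ofAdd, Int.cast_one, mul_one]

/-- The `z`-coordinates of `(ĥ_N x)_N` form a compatible family, hence come from some `t ∈ Ẑ`.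
[cite: MochizukiEtTh2009, §1 p.12] -/
theorem exists_zHat_forall_hHat_z_eq (x : F₂hatT) :
    ∃ t : ZH, ∀ N : ℕ+, Multiplicative.toAdd (modN N t) = (hHat N x).z := by
  refine exists_zHat_forall_modN_eq (fun N => (hHat N x).z) fun n N h => ?_
  have := congrArg Heis.z (map_hHat_of_dvd h x)
  simpa using this

/-- The `y`-coordinates of `(ĥ_N x)_N` form a compatible family, hence come from some `t ∈ Ẑ`.
[cite: MochizukiEtTh2009, §1 p.12] -/
theorem exists_zHat_forall_hHat_y_eq (x : F₂hatT) :
    ∃ t : ZH, ∀ N : ℕ+, Multiplicative.toAdd (modN N t) = (hHat N x).y := by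
  refine exists_zHat_forall_modN_eq (fun N => (hHat N x).y) fun n N h => ?_
  have := congrArg Heis.y (map_hHat_of_dvd h x)
  simpa using this

/-- An element of `Ẑ` is determined by its levels `modN N`. [cite: RibesZalesskii2010, Thm 2.7.1] -/
theorem ext_of_modN {t t' : ZH} (h : ∀ N : ℕ+, modN N t = modN N t') : t = t' :=
  ZHatLevel.ext_of_level fun N => by rw [← modN_eq_level, ← modN_eq_level, h N]

/-! ### `c^Ẑ ⊆ [F̂₂,F̂₂]⁻` for `c = ⁅a,b⁆` -/

/-- **Existence of `c^· : Ẑ → F̂₂`**, a continuous homomorphism with `ι 1 ↦ η ⁅a,b⁆` (pointed universal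
property of `Ẑ`, abc-iut-L4 `ZHatCompletion.exists_continuousMonoidHom_apply_eq`). [cite: MochizukiEtTh2009, §1 p.12] -/
theorem exists_cPow : ∃ f : ZH →ₜ* F₂hatT,
    f (iotaZ (Multiplicative.ofAdd 1)) = eta ⁅FreeGroup.of (0 : Fin 2), FreeGroup.of 1⁆ :=
  ZHatCompletion.exists_continuousMonoidHom_apply_eq (P := F₂hatT) _

section CPow

variable (f : ZH →ₜ* F₂hatT) (hf : f (iotaZ (Multiplicative.ofAdd 1)) = eta ⁅FreeGroup.of (0 : Fin 2), FreeGroup.of 1⁆)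
include hf

/-- `c^{ι k} = η(c^k)`. [cite: MochizukiEtTh2009, §1 p.12] -/
theorem apply_iotaZ_of_cPowSpec (k : Multiplicative ℤ) :
    f (iotaZ k) = eta (⁅FreeGroup.of (0 : Fin 2), FreeGroup.of 1⁆ ^ Multiplicative.toAdd k) := by
  have h : f.toMonoidHom.comp iotaZ = (zpowersHom F₂hatT (eta ⁅FreeGroup.of (0 : Fin 2), FreeGroup.of 1⁆)) := by
    refine MonoidHom.ext_mint ?_
    change f (iotaZ (Multiplicative.ofAdd 1)) = _
    rw [hf, zpowersHom_apply, toAdd_ofAdd, zpow_one]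
  have := DFunLike.congr_fun h k
  simpa [map_zpow] using this

/-- **`ĥ_N(c^t) = (0, 0, t mod N)`** (density of `ι(ℤ)` in `Ẑ`; on `ι k` both sides are `(0,0,k)` by
`hHat_eta_commutator_zpow`). [cite: MochizukiEtTh2009, §1 p.12] -/
theorem hHat_apply_of_cPowSpec (N : ℕ+) (t : ZH) :
    hHat N (f t) = ⟨0, 0, Multiplicative.toAdd (modN N t)⟩ := by
  have hdense : DenseRange iotaZ :=
    ProfiniteGrp.ProfiniteCompletion.denseRange (G := GrpCat.of (Multiplicative ℤ))
  have hc1 : Continuous fun t : ZH => hHat N (f t) := (hHat N).continuous.comp f.continuous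
  have hc2 : Continuous fun t : ZH => (⟨0, 0, Multiplicative.toAdd (modN N t)⟩ : Heis (ZMod N)) :=
    (continuous_of_discreteTopology (f := fun m : Multiplicative (ZMod N) =>
      (⟨0, 0, Multiplicative.toAdd m⟩ : Heis (ZMod N)))).comp (modN N).continuous
  have key := hdense.equalizer hc1 hc2 (funext fun k => by
    simp only [Function.comp_apply, apply_iotaZ_of_cPowSpec f hf, hHat_eta_commutator_zpow, modN_iotaZ,
      toAdd_ofAdd])
  exact congrFun key t

/-- `ê(c^t) = 1` (the `a`-degree of `c^t` vanishes). [cite: MochizukiEtTh2009, §1 p.12] -/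
theorem eHat_apply_of_cPowSpec (t : ZH) : eHat (f t) = 1 := by
  have h := ZHatCompletion.monoidHom_ext_of_continuous
    (f₁ := eHat.toMonoidHom.comp f.toMonoidHom) (f₂ := (1 : ZH →* ZH))
    (eHat.continuous.comp f.continuous) continuous_const (by
      change eHat (f (iotaZ (Multiplicative.ofAdd 1))) = 1
      rw [hf, eHat_eta, expA_apply, map_commutatorElement, Heis.commutatorElement_eq]
      simp)
  exact DFunLike.congr_fun h t

/-- `c^t ∈ [F̂₂,F̂₂]⁻`. [cite: MochizukiEtTh2009, §1 p.12] -/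
theorem apply_mem_closure_commutator_of_cPowSpec (t : ZH) :
    f t ∈ (⁅(⊤ : Subgroup F₂hatT), (⊤ : Subgroup F₂hatT)⁆).topologicalClosure := by
  rw [mem_closure_commutator₂_iff_forall_hHat]
  intro N
  rw [hHat_apply_of_cPowSpec f hf]
  exact ⟨rfl, rfl⟩

/-- **`c^t ∈ [[F̂₂,F̂₂],F̂₂]⁻ ⇒ t = 1`** — injectivity of the `Ẑ`-coordinate on the theta centre.
[cite: MochizukiEtTh2009, §1 p.12] -/
theorem eq_one_of_cPow_mem_closure₃ {t : ZH}
    (ht : f t ∈ (⁅⁅(⊤ : Subgroup F₂hatT), (⊤ : Subgroup F₂hatT)⁆, (⊤ : Subgroup F₂hatT)⁆).topologicalClosure) :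
    t = 1 := by
  rw [mem_closure_commutator₃_iff_forall_hHat] at ht
  refine ext_of_modN fun N => ?_
  have h := congrArg Heis.z (ht N)
  rw [hHat_apply_of_cPowSpec f hf] at h
  simp only [Heis.one_z] at h
  rw [map_one, ← ofAdd_toAdd (modN N t), h, ofAdd_zero]

/-- **Every element of `[F̂₂,F̂₂]⁻` is `≡ c^t (mod [[F̂₂,F̂₂],F̂₂]⁻)` for some `t ∈ Ẑ`** — surjectivity of the
`Ẑ`-coordinate on the theta centre `Δ_Θ`. [cite: MochizukiEtTh2009, §1 p.12] -/
theorem exists_mul_inv_cPow_mem_closure₃ {x : F₂hatT}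
    (hx : x ∈ (⁅(⊤ : Subgroup F₂hatT), (⊤ : Subgroup F₂hatT)⁆).topologicalClosure) :
    ∃ t : ZH, x * (f t)⁻¹ ∈
      (⁅⁅(⊤ : Subgroup F₂hatT), (⊤ : Subgroup F₂hatT)⁆, (⊤ : Subgroup F₂hatT)⁆).topologicalClosure ∧
      ∀ N : ℕ+, hHat N x = ⟨0, 0, Multiplicative.toAdd (modN N t)⟩ := by
  obtain ⟨t, htz⟩ := exists_zHat_forall_hHat_z_eq x
  rw [mem_closure_commutator₂_iff_forall_hHat] at hx
  have hxN : ∀ N : ℕ+, hHat N x = ⟨0, 0, Multiplicative.toAdd (modN N t)⟩ := fun N => by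
    obtain ⟨h1, h2⟩ := hx N
    ext
    · simpa using h1
    · simpa using h2
    · simp [htz N]
  refine ⟨t, ?_, hxN⟩
  rw [mem_closure_commutator₃_iff_forall_hHat]
  intro N
  rw [map_mul, map_inv, hxN N, hHat_apply_of_cPowSpec f hf]
  ext <;> simp

/-- The coset of `x ∈ [F̂₂,F̂₂]⁻` modulo `[[F̂₂,F̂₂],F̂₂]⁻` determines its coordinate: if `x ≡ c^t` and `x ≡ c^t'`
then `t = t'`. [cite: MochizukiEtTh2009, §1 p.12] -/
theorem cPow_coordinate_unique {x : F₂hatT} {t t' : ZH}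
    (ht : x * (f t)⁻¹ ∈ (⁅⁅(⊤ : Subgroup F₂hatT), (⊤ : Subgroup F₂hatT)⁆, (⊤ : Subgroup F₂hatT)⁆).topologicalClosure)
    (ht' : x * (f t')⁻¹ ∈ (⁅⁅(⊤ : Subgroup F₂hatT), (⊤ : Subgroup F₂hatT)⁆, (⊤ : Subgroup F₂hatT)⁆).topologicalClosure) :
    t = t' := by
  have hmem : f (t * t'⁻¹) ∈
      (⁅⁅(⊤ : Subgroup F₂hatT), (⊤ : Subgroup F₂hatT)⁆, (⊤ : Subgroup F₂hatT)⁆).topologicalClosure := by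
    have h := Subgroup.mul_mem _ (Subgroup.inv_mem _ ht) ht'
    have heq : (x * (f t)⁻¹)⁻¹ * (x * (f t')⁻¹) = f t * (f t')⁻¹ := by group
    rw [heq] at h
    rwa [map_mul, map_inv]
  have := eq_one_of_cPow_mem_closure₃ f hf hmem
  rwa [mul_inv_eq_one] at this

/-! ### The twist acts on the theta centre through `Aut(Ẑ)` itself: `Δ_Θ ≅ Ẑ(χ)` -/

/-- The level formula for the twist on `c^t`: `ĥ_N(θ_φ(c^t)) = (0, 0, χ_N(φ)·(t mod N))`.
[cite: MochizukiEtTh2009, §1 p.12] -/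
theorem hHat_twist_cPow (φ : MulAut ZH) (N : ℕ+) (t : ZH) :
    hHat N (twist φ (f t)) = ⟨0, 0, ZHatLevel.levelChar N φ * Multiplicative.toAdd (modN N t)⟩ := by
  rw [hHat_twist, hHat_apply_of_cPowSpec f hf]
  ext <;> simp

/-- **`θ_φ(c^t) ≡ c^{φ t} (mod [[F̂₂,F̂₂],F̂₂]⁻)`**: in the `Ẑ`-coordinates of the theta centre the twist `θ_φ`
(`a ↦ a`, `b ↦ b^φ`) IS `φ`. At the twisted model `φ = χ(σ)`, i.e. `Δ_Θ ≅ Ẑ(χ) = Ẑ(1)` — the cyclotomic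
action that makes Kummer theory non-vacuous there. [cite: MochizukiEtTh2009, §1 p.12] -/
theorem twist_cPow_mul_inv_mem_closure₃ (φ : MulAut ZH) (t : ZH) :
    twist φ (f t) * (f (φ t))⁻¹ ∈
      (⁅⁅(⊤ : Subgroup F₂hatT), (⊤ : Subgroup F₂hatT)⁆, (⊤ : Subgroup F₂hatT)⁆).topologicalClosure := by
  rw [mem_closure_commutator₃_iff_forall_hHat]
  intro N
  rw [map_mul, map_inv, hHat_twist_cPow f hf, hHat_apply_of_cPowSpec f hf, modN_eq_level, modN_eq_level,
    ZHatLevel.toAdd_level_aut]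
  ext <;> simp

/-- `θ_φ(c^t) ∈ [F̂₂,F̂₂]⁻` (the twist preserves the derived closure). [cite: MochizukiEtTh2009, §1 p.12] -/
theorem twist_cPow_mem_closure_commutator (φ : MulAut ZH) (t : ZH) :
    twist φ (f t) ∈ (⁅(⊤ : Subgroup F₂hatT), (⊤ : Subgroup F₂hatT)⁆).topologicalClosure := by
  rw [mem_closure_commutator₂_iff_forall_hHat]
  intro N
  rw [hHat_twist_cPow f hf]
  exact ⟨rfl, rfl⟩

end CPow

/-- The twist preserves `[F̂₂,F̂₂]⁻` (level-wise: `diagTwist` fixes `x = y = 0`). [cite: MochizukiEtTh2009, §1 p.12] -/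
theorem twist_mem_closure_commutator (φ : MulAut ZH) {x : F₂hatT}
    (hx : x ∈ (⁅(⊤ : Subgroup F₂hatT), (⊤ : Subgroup F₂hatT)⁆).topologicalClosure) :
    twist φ x ∈ (⁅(⊤ : Subgroup F₂hatT), (⊤ : Subgroup F₂hatT)⁆).topologicalClosure := by
  rw [mem_closure_commutator₂_iff_forall_hHat] at hx ⊢
  intro N
  obtain ⟨h1, h2⟩ := hx N
  rw [hHat_twist]
  exact ⟨by simp [h1], by simp [h2]⟩

/-- The twist preserves `[[F̂₂,F̂₂],F̂₂]⁻` (level-wise: the level maps kill it). [cite: MochizukiEtTh2009, §1 p.12] -/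
theorem twist_mem_closure_commutator₃ (φ : MulAut ZH) {x : F₂hatT}
    (hx : x ∈ (⁅⁅(⊤ : Subgroup F₂hatT), (⊤ : Subgroup F₂hatT)⁆, (⊤ : Subgroup F₂hatT)⁆).topologicalClosure) :
    twist φ x ∈ (⁅⁅(⊤ : Subgroup F₂hatT), (⊤ : Subgroup F₂hatT)⁆, (⊤ : Subgroup F₂hatT)⁆).topologicalClosure := by
  rw [mem_closure_commutator₃_iff_forall_hHat] at hx ⊢
  intro N
  rw [hHat_twist, hx N, map_one]

/-- **The twist acts on the `z`-coordinate of any `x ∈ [F̂₂,F̂₂]⁻` by the cyclotomic character**: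
`ĥ_N(θ_φ x).z = χ_N(φ) · ĥ_N(x).z`. [cite: MochizukiEtTh2009, §1 p.12] -/
theorem hHat_twist_z (φ : MulAut ZH) (N : ℕ+) (x : F₂hatT) :
    (hHat N (twist φ x)).z = ZHatLevel.levelChar N φ * (hHat N x).z := by
  rw [hHat_twist]
  simp

end Literature.AnabelianGeometry.EtaleTheta.SettingModel

end
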